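import Summits.SmoothPoincare4.SmoothPoincare4.Theorems.EntropyRungSubcylindricalRecognitionConeTestFunction
import Summits.SmoothPoincare4.SmoothPoincare4.Theorems.EntropyRungSubcylindricalRecognitionMuEntropyTestFunction
import Summits.SmoothPoincare4.SmoothPoincare4.Theorems.EntropyRungSubcylindricalRecognitionMultiplicityLintegral
import HarnessLib

/-!
# Cone exclusion for line `ancient-sphere-rigidity` — the core inequality

Crux `EntropyRung.SubcylindricalRecognition` (stmt-SmoothPoincare4-10869), line `ancient-sphere-rigidity`,
skeleton r6 (lead glue). `coneCore` (registered helper): with the data of `coneTestFunction`, the fibre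
cardinality `k`, the per-piece volume comparison (conclusion of `stub_injOnVolumeComparison`, hypothesis
`hper`) and the annulus arithmetic at the given parameters (conclusion of `stub_coneAnnulusArithmetic`,
hypothesis `harith`), Perelman's entropy satisfies `μ(h, τ) < m`. Uses the landed stubs
`stub_muEntropyTestFunction` (p76729) and `stub_multiplicityLintegral` (p76657). Fact-free.
-/

noncomputable section

open scoped Manifold ContDiff Topology ENNReal NNReal ContinuousMap
open Set MeasureTheory Filter
open Literature.Geometry.Lorentzian Literature.Geometry.Riemannian

namespace Summit.SmoothPoincare4.SmoothPoincare4.Theorems.SubcylindricalRecognition.AncientSphereRigidity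

/-- **Cone exclusion on a closed Riemannian 4-manifold (core).** If a closed Riemannian 4-manifold
`(M, h)` contains the `(1±η)`-almost-isometric `k`-to-`1` image `Φ(A)` of the Euclidean annulus
`A = {ε < |y| < r'}` with the descent `ρ` of `|y|²`, scalar curvature `|R_h| ≤ Λ` on `Φ(A)`, the per-piece
volume comparison `hper` (conclusion of `stub_injOnVolumeComparison`) and the parameters below the
thresholds of the annulus arithmetic (hypothesis `harith` = the conclusion of `stub_coneAnnulusArithmetic`
at these parameters), then `μ(h, τ) < m`. Test function from `coneTestFunction`; `stub_muEntropyTestFunction`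
bounds `μ`; `stub_multiplicityLintegral` transplants the three integrals to `A`. [folklore] -/
theorem coneCore :
    ∀
      (M : Type) [TopologicalSpace M] [T2Space M] [SecondCountableTopology M]
      [ChartedSpace (EuclideanSpace ℝ (Fin 4)) M] [IsManifold (𝓡 4) ∞ M] [CompactSpace M]
      [T3Space M] [MeasurableSpace M] [BorelSpace M]
      (h : PseudoRiemannianMetric (𝓡 4) ∞ (EuclideanSpace ℝ (Fin 4)) (TangentSpace (𝓡 4) : M → Type _))
      (hh : h.IsRiemannian)
      (cov : CovariantDerivative (𝓡 4) (EuclideanSpace ℝ (Fin 4)) (TangentSpace (𝓡 4) : M → Type _))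
      (hR : Continuous fun x ↦ h.scalarCurvatureWith cov x)
      (k : ℕ) (hk : 1 ≤ k) (m η τ Λ ε r' : ℝ) (hη1 : η < 1) (hτ : 0 < τ)
      (hε : 0 < ε) (hr' : 0 < r') (hεr : 8 * ε ^ 2 < 3 * r' ^ 2)
      (Φ : EuclideanSpace ℝ (Fin 4) → M) (ρ : M → ℝ)
      (hΦ : ContMDiffOn (𝓡 4) (𝓡 4) ∞ Φ (Metric.ball 0 r' \ Metric.closedBall 0 ε))
      (hopen : IsOpen (Φ '' (Metric.ball 0 r' \ Metric.closedBall 0 ε)))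
      (hmf : ∀ y ∈ Metric.ball (0 : EuclideanSpace ℝ (Fin 4)) r' \ Metric.closedBall 0 ε,
        Function.Injective (mfderiv (𝓡 4) (𝓡 4) Φ y))
      (hfib : ∀ y ∈ Metric.ball (0 : EuclideanSpace ℝ (Fin 4)) r' \ Metric.closedBall 0 ε,
        (Φ ⁻¹' {Φ y} ∩ (Metric.ball 0 r' \ Metric.closedBall 0 ε)).ncard = k)
      (hρ : ContMDiffOn (𝓡 4) 𝓘(ℝ, ℝ) ∞ ρ (Φ '' (Metric.ball 0 r' \ Metric.closedBall 0 ε)))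
      (hdesc : ∀ y ∈ Metric.ball (0 : EuclideanSpace ℝ (Fin 4)) r' \ Metric.closedBall 0 ε,
        ρ (Φ y) = ‖y‖ ^ 2)
      (hcomp : ∀ y ∈ Metric.ball (0 : EuclideanSpace ℝ (Fin 4)) r' \ Metric.closedBall 0 ε,
        ∀ v : EuclideanSpace ℝ (Fin 4),
          (1 - η) * ‖v‖ ^ 2 ≤ h.val (Φ y) (mfderiv (𝓡 4) (𝓡 4) Φ y v) (mfderiv (𝓡 4) (𝓡 4) Φ y v))
      (hRΛ : ∀ y ∈ Metric.ball (0 : EuclideanSpace ℝ (Fin 4)) r' \ Metric.closedBall 0 ε,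
        |h.scalarCurvatureWith cov (Φ y)| ≤ Λ)
      (hper : ∀ U ⊆ Metric.ball (0 : EuclideanSpace ℝ (Fin 4)) r' \ Metric.closedBall 0 ε, IsOpen U →
        Set.InjOn Φ U → ∀ S ⊆ U, MeasurableSet S →
          ENNReal.ofReal ((1 - η) ^ 2) * volume S ≤ h.riemVolume (Φ '' S) ∧
            h.riemVolume (Φ '' S) ≤ ENNReal.ofReal ((1 + η) ^ 2) * volume S)
      (harith : ∀ (J₀ J₁ J₂ : ℝ),
        (1 - η) ^ 2 *
            (∫ y in (Metric.ball (0 : EuclideanSpace ℝ (Fin 4)) r' \ Metric.closedBall 0 ε),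
              (Real.exp (-‖y‖ ^ 2 / (8 * τ)) *
                (Real.smoothTransition (‖y‖ ^ 2 / (2 * ε ^ 2) - 1) *
                  Real.smoothTransition (3 - 4 * ‖y‖ ^ 2 / r' ^ 2))) ^ 2 ∂volume) ≤ k * J₀ →
        k * J₀ ≤ (1 + η) ^ 2 *
            (∫ y in (Metric.ball (0 : EuclideanSpace ℝ (Fin 4)) r' \ Metric.closedBall 0 ε),
              (Real.exp (-‖y‖ ^ 2 / (8 * τ)) *
                (Real.smoothTransition (‖y‖ ^ 2 / (2 * ε ^ 2) - 1) *
                  Real.smoothTransition (3 - 4 * ‖y‖ ^ 2 / r' ^ 2))) ^ 2 ∂volume) →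
        0 ≤ J₁ →
        k * J₁ ≤ (1 + η) ^ 2 *
            (∫ y in (Metric.ball (0 : EuclideanSpace ℝ (Fin 4)) r' \ Metric.closedBall 0 ε),
              16 * ‖y‖ ^ 2 *
                (deriv (fun s : ℝ ↦ Real.exp (-s / (8 * τ)) *
                  (Real.smoothTransition (s / (2 * ε ^ 2) - 1) *
                    Real.smoothTransition (3 - 4 * s / r' ^ 2))) (‖y‖ ^ 2)) ^ 2 / (1 - η) ∂volume) →
        0 ≤ J₂ →
        k * J₂ ≤ (1 + η) ^ 2 *
            (∫ y in (Metric.ball (0 : EuclideanSpace ℝ (Fin 4)) r' \ Metric.closedBall 0 ε),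
              -((Real.exp (-‖y‖ ^ 2 / (8 * τ)) *
                  (Real.smoothTransition (‖y‖ ^ 2 / (2 * ε ^ 2) - 1) *
                    Real.smoothTransition (3 - 4 * ‖y‖ ^ 2 / r' ^ 2))) ^ 2 *
                Real.log ((Real.exp (-‖y‖ ^ 2 / (8 * τ)) *
                  (Real.smoothTransition (‖y‖ ^ 2 / (2 * ε ^ 2) - 1) *
                    Real.smoothTransition (3 - 4 * ‖y‖ ^ 2 / r' ^ 2))) ^ 2)) ∂volume) →
        τ * Λ + (τ * J₁ + J₂) / J₀ + Real.log J₀ - 2 * Real.log (4 * Real.pi * τ) - 4 < m),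
      h.muEntropy cov τ < (m : EReal) := by
  intro M _ _ _ _ _ _ _ _ _ h hh cov hR k hk m η τ Λ ε r' hη1 hτ hε hr' hεr Φ ρ hΦ hopen hmf hfib hρ hdesc hcomp hRΛ hper harith
  classical
  obtain ⟨W, w, F₁, f₂, hWdef, hWsmooth, hW0, hW1, hWpos, hws, hF₁c, hf₂c, hw_nn, hw_le, hF₁_nn, hf₂_nn,
      hf₂app, hwVc, hF₁Vc, hwΦ, hF₁Φ, hgrad_le, hRw_le⟩ :=
    coneTestFunction M h cov η τ Λ ε r' hη1 hτ hε hr' Φ ρ hΦ hopen hmf hρ hdesc hcomp hRΛ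
  obtain ⟨A, hA⟩ : ∃ A : Set (EuclideanSpace ℝ (Fin 4)), A = Metric.ball 0 r' \ Metric.closedBall 0 ε :=
    ⟨_, rfl⟩
  rw [← hA] at hΦ hopen hmf hfib hρ hdesc hcomp hRΛ hper harith hwVc hF₁Vc hwΦ hF₁Φ
  have hAo : IsOpen A := by rw [hA]; exact Metric.isOpen_ball.sdiff Metric.isClosed_closedBall
  have hmemA : ∀ {y : EuclideanSpace ℝ (Fin 4)}, y ∈ A ↔ ε < ‖y‖ ∧ ‖y‖ < r' := by
    intro y
    simp only [hA, Set.mem_sdiff, Metric.mem_ball, dist_zero_right, Metric.mem_closedBall, not_le]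
    tauto
  have hAsub : A ⊆ Metric.closedBall (0 : EuclideanSpace ℝ (Fin 4)) r' := by
    rw [hA]; exact Set.sdiff_subset.trans Metric.ball_subset_closedBall
  have hnsq : Continuous fun y : EuclideanSpace ℝ (Fin 4) ↦ ‖y‖ ^ 2 := by fun_prop
  have hW'cont : Continuous (deriv W) := hWsmooth.continuous_deriv (by simp)
  have hwc : Continuous w := hws.continuous
  have hw2c : Continuous fun x ↦ w x ^ 2 := hwc.pow 2
  have h1η : 0 < 1 - η := by linarith only [hη1]
  -- ### local injectivity of `Φ` (inverse function theorem)
  have hlocinj : ∀ y ∈ A, ∃ U : Set (EuclideanSpace ℝ (Fin 4)), IsOpen U ∧ y ∈ U ∧ U ⊆ A ∧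
      Set.InjOn Φ U := by
    intro y hy
    have hld : IsLocalDiffeomorphAt (𝓡 4) (𝓡 4) ∞ Φ y :=
      Literature.Topology.FourManifolds.isLocalDiffeomorphAt_of_mfderiv_injective hAo hy hΦ
        (by simp) rfl (hmf y hy)
    obtain ⟨e, hye, heq⟩ := hld
    refine ⟨e.source ∩ A, e.open_source.inter hAo, ⟨hye, hy⟩, inter_subset_right, ?_⟩
    intro a ha b hb hab
    have h1 : e a = e b := by rw [← heq ha.1, ← heq hb.1]; exact hab
    exact e.toPartialEquiv.injOn ha.1 hb.1 h1
  -- ### the `k`-sheeted comparison (Stub 5, with the per-piece comparison `hper`)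
  have hsheet := stub_multiplicityLintegral M h hh Φ A k (ENNReal.ofReal ((1 - η) ^ 2)) (ENNReal.ofReal ((1 + η) ^ 2))
    hk hAo hΦ hlocinj hopen hfib hper
  -- ### Euclidean integrands
  obtain ⟨g₀, hg₀⟩ : ∃ g : EuclideanSpace ℝ (Fin 4) → ℝ, g = fun y ↦ W (‖y‖ ^ 2) ^ 2 := ⟨_, rfl⟩
  obtain ⟨g₁, hg₁⟩ : ∃ g : EuclideanSpace ℝ (Fin 4) → ℝ,
      g = fun y ↦ 16 * ‖y‖ ^ 2 * (deriv W (‖y‖ ^ 2)) ^ 2 / (1 - η) := ⟨_, rfl⟩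
  obtain ⟨g₂, hg₂⟩ : ∃ g : EuclideanSpace ℝ (Fin 4) → ℝ,
      g = fun y ↦ -(W (‖y‖ ^ 2) ^ 2 * Real.log (W (‖y‖ ^ 2) ^ 2)) := ⟨_, rfl⟩
  have hg₀c : Continuous g₀ := by rw [hg₀]; exact (hWsmooth.continuous.comp hnsq).pow 2
  have hg₁c : Continuous g₁ := by
    rw [hg₁]; exact ((continuous_const.mul hnsq).mul ((hW'cont.comp hnsq).pow 2)).div_const _
  have hg₂c : Continuous g₂ := by
    rw [hg₂]; exact (Real.continuous_mul_log.comp ((hWsmooth.continuous.comp hnsq).pow 2)).neg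
  have hg₀nn : ∀ y, 0 ≤ g₀ y := fun y ↦ by rw [hg₀]; exact sq_nonneg _
  have hg₁nn : ∀ y, 0 ≤ g₁ y := fun y ↦ by
    rw [hg₁]
    exact div_nonneg (mul_nonneg (mul_nonneg (by norm_num) (sq_nonneg _)) (sq_nonneg _)) h1η.le
  have hg₂nn : ∀ y, 0 ≤ g₂ y := fun y ↦ by
    rw [hg₂]
    have h0 : 0 ≤ W (‖y‖ ^ 2) := hW0 _
    have h1 : W (‖y‖ ^ 2) ^ 2 ≤ 1 := by
      have := hW1 (‖y‖ ^ 2) (sq_nonneg _)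
      calc W (‖y‖ ^ 2) ^ 2 = W (‖y‖ ^ 2) * W (‖y‖ ^ 2) := sq _
        _ ≤ 1 * 1 := mul_le_mul this this h0 zero_le_one
        _ = 1 := one_mul _
    have h2 : Real.log (W (‖y‖ ^ 2) ^ 2) ≤ 0 := Real.log_nonpos (sq_nonneg _) h1
    have h3 := mul_nonpos_of_nonneg_of_nonpos (sq_nonneg (W (‖y‖ ^ 2))) h2
    show 0 ≤ -(W (‖y‖ ^ 2) ^ 2 * Real.log (W (‖y‖ ^ 2) ^ 2))
    linarith only [h3]
  have hint : ∀ {g : EuclideanSpace ℝ (Fin 4) → ℝ}, Continuous g → IntegrableOn g A volume :=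
    fun hg ↦ (hg.continuousOn.integrableOn_compact (isCompact_closedBall _ _)).mono_set hAsub
  -- values along `Φ` on `A`
  have hG₀Φ : ∀ y ∈ A, ENNReal.ofReal (w (Φ y) ^ 2) = ENNReal.ofReal (g₀ y) := fun y hy ↦ by
    rw [hwΦ y hy, hg₀]
  have hG₁Φ : ∀ y ∈ A, ENNReal.ofReal (F₁ (Φ y)) = ENNReal.ofReal (g₁ y) := fun y hy ↦ by
    rw [hF₁Φ y hy, hg₁]
  have hG₂Φ : ∀ y ∈ A, ENNReal.ofReal (f₂ (Φ y)) = ENNReal.ofReal (g₂ y) := fun y hy ↦ by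
    rw [hf₂app, hwΦ y hy, hg₂]
  -- ### transfer of the three integrals
  haveI : IsFiniteMeasure h.riemVolume := ⟨h.riemVolume_univ_lt_top⟩
  have htransfer : ∀ {F : M → ℝ} {g : EuclideanSpace ℝ (Fin 4) → ℝ}, Continuous F → Continuous g →
      (∀ x, 0 ≤ F x) → (∀ y, 0 ≤ g y) → (∀ x ∉ Φ '' A, F x = 0) →
      (∀ y ∈ A, ENNReal.ofReal (F (Φ y)) = ENNReal.ofReal (g y)) →
      (1 - η) ^ 2 * (∫ y in A, g y ∂volume) ≤ k * ∫ x, F x ∂h.riemVolume ∧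
        k * ∫ x, F x ∂h.riemVolume ≤ (1 + η) ^ 2 * (∫ y in A, g y ∂volume) := by
    intro F g hFc hgc hFnn hgnn hF0 hFg
    have hmeas : Measurable fun x ↦ ENNReal.ofReal (F x) :=
      ENNReal.measurable_ofReal.comp hFc.measurable
    obtain ⟨hlo, hup⟩ := hsheet _ hmeas
    -- the `M`-side
    have hsupp : (Function.support fun x ↦ ENNReal.ofReal (F x)) ⊆ Φ '' A := by
      intro x hx
      by_contra hxV
      exact hx (by simp [hF0 x hxV])
    have hM : ∫⁻ x in Φ '' A, ENNReal.ofReal (F x) ∂h.riemVolume =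
        ENNReal.ofReal (∫ x, F x ∂h.riemVolume) := by
      rw [setLIntegral_eq_of_support_subset hsupp]
      exact (ofReal_integral_eq_lintegral_ofReal (h.integrable_of_continuous hFc)
        (Eventually.of_forall hFnn)).symm
    -- the Euclidean side
    have hE : ∫⁻ y in A, ENNReal.ofReal (F (Φ y)) ∂volume =
        ENNReal.ofReal (∫ y in A, g y ∂volume) := by
      rw [setLIntegral_congr_fun hAo.measurableSet hFg]
      exact (ofReal_integral_eq_lintegral_ofReal (hint hgc) (Eventually.of_forall hgnn)).symm
    rw [hM, hE] at hlo hup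
    have hkZ : (k : ℝ≥0∞) * ENNReal.ofReal (∫ x, F x ∂h.riemVolume) =
        ENNReal.ofReal (k * ∫ x, F x ∂h.riemVolume) := by
      rw [ENNReal.ofReal_mul (Nat.cast_nonneg k), ENNReal.ofReal_natCast]
    have hIg : 0 ≤ ∫ y in A, g y ∂volume := setIntegral_nonneg hAo.measurableSet (fun y _ ↦ hgnn y)
    have hIF : 0 ≤ ∫ x, F x ∂h.riemVolume := integral_nonneg hFnn
    rw [hkZ, ← ENNReal.ofReal_mul (sq_nonneg _)] at hlo
    rw [hkZ, ← ENNReal.ofReal_mul (sq_nonneg _)] at hup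
    have hkF : 0 ≤ (k : ℝ) * ∫ x, F x ∂h.riemVolume := mul_nonneg (Nat.cast_nonneg k) hIF
    have hηg : 0 ≤ (1 + η) ^ 2 * ∫ y in A, g y ∂volume := mul_nonneg (sq_nonneg _) hIg
    exact ⟨(ENNReal.ofReal_le_ofReal_iff hkF).mp hlo, (ENNReal.ofReal_le_ofReal_iff hηg).mp hup⟩
  obtain ⟨h0l, h0u⟩ := htransfer hw2c hg₀c (fun x ↦ sq_nonneg _) hg₀nn
    (fun x hx ↦ by rw [hwVc x hx]; simp) hG₀Φ
  obtain ⟨-, h1u⟩ := htransfer hF₁c hg₁c hF₁_nn hg₁nn hF₁Vc hG₁Φ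
  obtain ⟨-, h2u⟩ := htransfer hf₂c hg₂c hf₂_nn hg₂nn
    (fun x hx ↦ by rw [hf₂app, hwVc x hx]; simp) hG₂Φ
  have hJ₁nn : 0 ≤ ∫ x, F₁ x ∂h.riemVolume := integral_nonneg hF₁_nn
  have hJ₂nn : 0 ≤ ∫ x, f₂ x ∂h.riemVolume := integral_nonneg hf₂_nn
  -- ### positivity of `I₀ = ∫_A g₀`, hence of `Z = ∫ w²`
  have hI₀pos : 0 < ∫ y in A, g₀ y ∂volume := by
    have hs₀l : 2 * ε ^ 2 < (2 * ε ^ 2 + 3 * r' ^ 2 / 4) / 2 := by linarith only [hεr]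
    have hs₀u : (2 * ε ^ 2 + 3 * r' ^ 2 / 4) / 2 < 3 * r' ^ 2 / 4 := by linarith only [hεr]
    have hs₀pos : 0 < (2 * ε ^ 2 + 3 * r' ^ 2 / 4) / 2 := by positivity
    obtain ⟨y₀, hy₀⟩ : ∃ y₀ : EuclideanSpace ℝ (Fin 4),
        ‖y₀‖ = Real.sqrt ((2 * ε ^ 2 + 3 * r' ^ 2 / 4) / 2) :=
      exists_norm_eq (EuclideanSpace ℝ (Fin 4)) (Real.sqrt_nonneg _)
    have hy₀sq : ‖y₀‖ ^ 2 = (2 * ε ^ 2 + 3 * r' ^ 2 / 4) / 2 := by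
      rw [hy₀, Real.sq_sqrt hs₀pos.le]
    have hy₀A : y₀ ∈ A := by
      rw [hmemA, ← abs_of_nonneg (norm_nonneg y₀), ← abs_of_pos hε, ← abs_of_pos hr', ← sq_lt_sq,
        ← sq_lt_sq, hy₀sq]
      constructor
      · linarith only [hs₀l, pow_pos hε 2]
      · linarith only [hs₀u, pow_pos hr' 2]
    have hg₀y₀ : 0 < g₀ y₀ := by
      rw [hg₀]
      show 0 < W (‖y₀‖ ^ 2) ^ 2
      rw [hy₀sq]
      exact pow_pos (hWpos _ hs₀l hs₀u) 2
    rw [setIntegral_pos_iff_support_of_nonneg_ae (Eventually.of_forall (fun y ↦ hg₀nn y))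
      (hint hg₀c)]
    have hU : {y | 0 < g₀ y} ∩ A ∈ 𝓝 y₀ :=
      inter_mem ((isOpen_lt continuous_const hg₀c).mem_nhds hg₀y₀) (hAo.mem_nhds hy₀A)
    have hsub : {y | 0 < g₀ y} ∩ A ⊆ Function.support g₀ ∩ A :=
      fun y hy ↦ ⟨ne_of_gt hy.1, hy.2⟩
    exact lt_of_lt_of_le (Measure.measure_pos_of_mem_nhds volume hU) (measure_mono hsub)
  have hkpos : (0 : ℝ) < k := by exact_mod_cast hk
  have hZpos : 0 < ∫ x, w x ^ 2 ∂h.riemVolume := by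
    have h1 : 0 < (1 - η) ^ 2 * ∫ y in A, g₀ y ∂volume := mul_pos (pow_pos h1η 2) hI₀pos
    by_contra hZ0
    have h2 : (k : ℝ) * ∫ x, w x ^ 2 ∂h.riemVolume ≤ 0 :=
      mul_nonpos_of_nonneg_of_nonpos hkpos.le (not_lt.mp hZ0)
    linarith only [h1, h2, h0l]
  -- ### the test-function bound (Stub 3) and the annulus arithmetic
  have hμ := stub_muEntropyTestFunction M h hh cov hR τ hτ w hws hZpos
  rw [hg₀, hWdef] at h0l h0u
  rw [hg₁, hWdef] at h1u
  rw [hg₂, hWdef] at h2u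
  have hfinal := harith _ _ _ h0l h0u hJ₁nn h1u hJ₂nn h2u
  -- ### comparison of the numerator
  have hgradc : Continuous (h.gradSq w) :=
    continuous_innerDual_mvfderiv h (hws.of_le (by norm_num)) (hws.of_le (by norm_num))
  have hNfc : Continuous fun x ↦ τ * (h.scalarCurvatureWith cov x * w x ^ 2 + 4 * h.gradSq w x)
      - w x ^ 2 * Real.log (w x ^ 2) :=
    (continuous_const.mul ((hR.mul hw2c).add (continuous_const.mul hgradc))).sub
      (Real.continuous_mul_log.comp hw2c)
  have hBfc : Continuous fun x ↦ τ * (Λ * w x ^ 2 + F₁ x) + f₂ x :=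
    (continuous_const.mul ((continuous_const.mul hw2c).add hF₁c)).add hf₂c
  have hNB : ∀ x, τ * (h.scalarCurvatureWith cov x * w x ^ 2 + 4 * h.gradSq w x)
      - w x ^ 2 * Real.log (w x ^ 2) ≤ τ * (Λ * w x ^ 2 + F₁ x) + f₂ x := by
    intro x
    have h3 : τ * (h.scalarCurvatureWith cov x * w x ^ 2 + 4 * h.gradSq w x) ≤
        τ * (Λ * w x ^ 2 + F₁ x) :=
      mul_le_mul_of_nonneg_left (by linarith only [hRw_le x, hgrad_le x]) hτ.le
    rw [hf₂app]
    linarith only [h3]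
  have hNle : ∫ x, τ * (h.scalarCurvatureWith cov x * w x ^ 2 + 4 * h.gradSq w x)
      - w x ^ 2 * Real.log (w x ^ 2) ∂h.riemVolume ≤ ∫ x, τ * (Λ * w x ^ 2 + F₁ x) + f₂ x ∂h.riemVolume :=
    integral_mono (h.integrable_of_continuous hNfc) (h.integrable_of_continuous hBfc) hNB
  have hBval : ∫ x, τ * (Λ * w x ^ 2 + F₁ x) + f₂ x ∂h.riemVolume =
      τ * (Λ * ∫ x, w x ^ 2 ∂h.riemVolume + ∫ x, F₁ x ∂h.riemVolume) + ∫ x, f₂ x ∂h.riemVolume := by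
    have i1 : Integrable (fun x ↦ w x ^ 2) h.riemVolume := h.integrable_of_continuous hw2c
    have i2 : Integrable F₁ h.riemVolume := h.integrable_of_continuous hF₁c
    have i3 : Integrable f₂ h.riemVolume := h.integrable_of_continuous hf₂c
    have i4 : Integrable (fun x ↦ Λ * w x ^ 2 + F₁ x) h.riemVolume := (i1.const_mul Λ).add i2
    have i5 : Integrable (fun x ↦ τ * (Λ * w x ^ 2 + F₁ x)) h.riemVolume := i4.const_mul τ
    have e1 : ∫ x, τ * (Λ * w x ^ 2 + F₁ x) + f₂ x ∂h.riemVolume =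
        (∫ x, τ * (Λ * w x ^ 2 + F₁ x) ∂h.riemVolume) + ∫ x, f₂ x ∂h.riemVolume :=
      integral_add i5 i3
    have e2 : ∫ x, τ * (Λ * w x ^ 2 + F₁ x) ∂h.riemVolume = τ * ∫ x, (Λ * w x ^ 2 + F₁ x) ∂h.riemVolume :=
      integral_const_mul τ _
    have e3 : ∫ x, (Λ * w x ^ 2 + F₁ x) ∂h.riemVolume =
        (∫ x, Λ * w x ^ 2 ∂h.riemVolume) + ∫ x, F₁ x ∂h.riemVolume := integral_add (i1.const_mul Λ) i2
    have e4 : ∫ x, Λ * w x ^ 2 ∂h.riemVolume = Λ * ∫ x, w x ^ 2 ∂h.riemVolume := integral_const_mul Λ _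
    rw [e1, e2, e3, e4]
  -- ### conclusion
  have hreal : (∫ x, τ * (h.scalarCurvatureWith cov x * w x ^ 2 + 4 * h.gradSq w x)
      - w x ^ 2 * Real.log (w x ^ 2) ∂h.riemVolume) / (∫ x, w x ^ 2 ∂h.riemVolume)
      + Real.log (∫ x, w x ^ 2 ∂h.riemVolume) - 2 * Real.log (4 * Real.pi * τ) - 4 < m := by
    have h1 := div_le_div_of_nonneg_right (hBval ▸ hNle) hZpos.le
    have h2 : (τ * (Λ * ∫ x, w x ^ 2 ∂h.riemVolume + ∫ x, F₁ x ∂h.riemVolume) +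
        ∫ x, f₂ x ∂h.riemVolume) / (∫ x, w x ^ 2 ∂h.riemVolume) =
        τ * Λ + (τ * ∫ x, F₁ x ∂h.riemVolume + ∫ x, f₂ x ∂h.riemVolume) /
          (∫ x, w x ^ 2 ∂h.riemVolume) := by
      field_simp; ring
    rw [h2] at h1
    linarith only [h1, hfinal]
  exact lt_of_le_of_lt hμ (EReal.coe_lt_coe_iff.mpr hreal)



end Summit.SmoothPoincare4.SmoothPoincare4.Theorems.SubcylindricalRecognition.AncientSphereRigidity

end
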